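import Summits.CriticalPhenomena.PercolationContinuityZ3.Theorems.PercNearOneGluingNoHeavyQuantAtMostOneAnalytic
import HarnessLib

/-!
# QUANT lane R8 — the envelope inequality for `r = 3`: `E(n, 3, y) ≤ 1` for all `n ≥ 7`, `0 ≤ y ≤ 1/2`

builds on p205010 (kernel theorem, internal audit signed; external expert review pending)

Support file (`--supports stmt-CriticalPhenomena-4575`), QUANT lane typer seat prim-quant-stmt (gen 20).  Theorems only (real analysis).  Discharges, for
`r = 3`, the envelope hypothesis of `…QuantAtMostRBound`:
`E(n, 3, y) = Σ_{i ≤ 3} C(n,i)·y^{n−1−i}(1 − y/2)^i·b^{n−i} ≤ 1`, `b = 2 − y − 6/n` — so "at least FOUR of `n`" (`P(X ≤ 3) ≤ 1 − x` whenever the credit rates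
sum to `≥ 6`) and DIB\* for tied blobs of size `s` with `3s ≤ j < 4s` follow (`…QuantTiedFour`).  Same scheme as `…QuantEnvelopeTwo`: `n = 7` by a degree-13
Bernstein-positive polynomial (minimum coefficient `0.54`); `n ≥ 8` by the two-interval endpoint argument (`[0, 3/10]`, `[3/10, 1/2]`), evaluations for
`n ≤ 14` / `n ≤ 36`, and the crude tails `(17/40)(n)³(51/100)^{n−4}`, `(11/50) n³ (3/4)^{n−4}`.  Numerics: `sup E(n,3,·) = 0.476` (`n = 10`, `y = 1/2`).  [this work]
-/

namespace Summit.CriticalPhenomena.PercolationContinuityZ3.Theorems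

namespace Quant

namespace IndepBlob

open Finset

/-! ### 1. Crude tails -/

/-- `(17/40)·(m+4)³·(51/100)^m ≤ 1` for `m ≥ 11`. [this work] -/
theorem crudeThreeOne_le_one (m : ℕ) (hm : 11 ≤ m) : (17 / 40 : ℝ) * ((m : ℝ) + 4) ^ 3 * (51 / 100) ^ m ≤ 1 := by
  induction m, hm using Nat.le_induction with
  | base => norm_num
  | succ m hm ih =>
    have hm' : (11 : ℝ) ≤ m := by exact_mod_cast hm
    have e : (17 / 40 : ℝ) * (((m + 1 : ℕ) : ℝ) + 4) ^ 3 * (51 / 100) ^ (m + 1) =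
        ((17 / 40 : ℝ) * ((m : ℝ) + 4) ^ 3 * (51 / 100) ^ m) * ((51 / 100) * (((m : ℝ) + 5) / ((m : ℝ) + 4)) ^ 3) := by
      push_cast; field_simp; ring
    rw [e]
    have hq : ((m : ℝ) + 5) / ((m : ℝ) + 4) ≤ 16 / 15 := by rw [div_le_iff₀ (by positivity)]; linarith
    have hq0 : 0 ≤ ((m : ℝ) + 5) / ((m : ℝ) + 4) := by positivity
    have hr : (51 / 100 : ℝ) * (((m : ℝ) + 5) / ((m : ℝ) + 4)) ^ 3 ≤ 1 := by
      have := pow_le_pow_left₀ hq0 hq 3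
      nlinarith
    have hpos : 0 ≤ (17 / 40 : ℝ) * ((m : ℝ) + 4) ^ 3 * (51 / 100) ^ m := by positivity
    calc _ ≤ 1 * ((51 / 100 : ℝ) * (((m : ℝ) + 5) / ((m : ℝ) + 4)) ^ 3) := mul_le_mul_of_nonneg_right ih (by positivity)
      _ ≤ 1 := by rw [one_mul]; exact hr

/-- `(11/50)·(m+4)³·(3/4)^m ≤ 1` for `m ≥ 33`. [this work] -/
theorem crudeThreeTwo_le_one (m : ℕ) (hm : 33 ≤ m) : (11 / 50 : ℝ) * ((m : ℝ) + 4) ^ 3 * (3 / 4) ^ m ≤ 1 := by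
  induction m, hm using Nat.le_induction with
  | base => norm_num
  | succ m hm ih =>
    have hm' : (33 : ℝ) ≤ m := by exact_mod_cast hm
    have e : (11 / 50 : ℝ) * (((m + 1 : ℕ) : ℝ) + 4) ^ 3 * (3 / 4) ^ (m + 1) =
        ((11 / 50 : ℝ) * ((m : ℝ) + 4) ^ 3 * (3 / 4) ^ m) * ((3 / 4) * (((m : ℝ) + 5) / ((m : ℝ) + 4)) ^ 3) := by
      push_cast; field_simp; ring
    rw [e]
    have hq : ((m : ℝ) + 5) / ((m : ℝ) + 4) ≤ 38 / 37 := by rw [div_le_iff₀ (by positivity)]; linarith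
    have hq0 : 0 ≤ ((m : ℝ) + 5) / ((m : ℝ) + 4) := by positivity
    have hr : (3 / 4 : ℝ) * (((m : ℝ) + 5) / ((m : ℝ) + 4)) ^ 3 ≤ 1 := by
      have := pow_le_pow_left₀ hq0 hq 3
      nlinarith
    have hpos : 0 ≤ (11 / 50 : ℝ) * ((m : ℝ) + 4) ^ 3 * (3 / 4) ^ m := by positivity
    calc _ ≤ 1 * ((3 / 4 : ℝ) * (((m : ℝ) + 5) / ((m : ℝ) + 4)) ^ 3) := mul_le_mul_of_nonneg_right ih (by positivity)
      _ ≤ 1 := by rw [one_mul]; exact hr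

/-! ### 2. The two frozen sums -/

/-- `P₁(n) ≤ 1` for `n = m + 4 ≥ 8`: the four terms frozen at `y = 3/10` with `(1 − y/2)^i ≤ 1`. [this work] -/
theorem pThreeOne_le_one (m : ℕ) (hm : 4 ≤ m) :
    (3 / 10 : ℝ) ^ (m + 3) * (17 / 10 - 6 / ((m : ℝ) + 4)) ^ (m + 4) +
      ((m : ℝ) + 4) * (3 / 10 : ℝ) ^ (m + 2) * (17 / 10 - 6 / ((m : ℝ) + 4)) ^ (m + 3) +
      ((m : ℝ) + 4) * ((m : ℝ) + 3) / 2 * (3 / 10 : ℝ) ^ (m + 1) * (17 / 10 - 6 / ((m : ℝ) + 4)) ^ (m + 2) +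
      ((m : ℝ) + 4) * ((m : ℝ) + 3) * ((m : ℝ) + 2) / 6 * (3 / 10 : ℝ) ^ m * (17 / 10 - 6 / ((m : ℝ) + 4)) ^ (m + 1) ≤ 1 := by
  by_cases h11 : 11 ≤ m
  · have hm0 : (11 : ℝ) ≤ m := by exact_mod_cast h11
    have hB : (17 / 10 - 6 / ((m : ℝ) + 4)) ≤ 17 / 10 := by
      have : 0 ≤ 6 / ((m : ℝ) + 4) := by positivity
      linarith
    have hB0 : 0 ≤ 17 / 10 - 6 / ((m : ℝ) + 4) := by
      rw [sub_nonneg, div_le_iff₀ (by positivity)]; nlinarith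
    have h1 := pow_le_pow_left₀ hB0 hB (m + 4)
    have h2 := pow_le_pow_left₀ hB0 hB (m + 3)
    have h3 := pow_le_pow_left₀ hB0 hB (m + 2)
    have h4 := pow_le_pow_left₀ hB0 hB (m + 1)
    have hc := crudeThreeOne_le_one m h11
    have e : (3 / 10 : ℝ) ^ (m + 3) * (17 / 10 : ℝ) ^ (m + 4) + ((m : ℝ) + 4) * (3 / 10 : ℝ) ^ (m + 2) * (17 / 10 : ℝ) ^ (m + 3) +
        ((m : ℝ) + 4) * ((m : ℝ) + 3) / 2 * (3 / 10 : ℝ) ^ (m + 1) * (17 / 10 : ℝ) ^ (m + 2) +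
        ((m : ℝ) + 4) * ((m : ℝ) + 3) * ((m : ℝ) + 2) / 6 * (3 / 10 : ℝ) ^ m * (17 / 10 : ℝ) ^ (m + 1) =
        (17 / 10 : ℝ) * (51 / 100) ^ m * ((51 / 100) ^ 3 + (51 / 100) ^ 2 * ((m : ℝ) + 4) + (51 / 100) * (((m : ℝ) + 4) * ((m : ℝ) + 3) / 2) +
          ((m : ℝ) + 4) * ((m : ℝ) + 3) * ((m : ℝ) + 2) / 6) := by
      have : (51 / 100 : ℝ) ^ m = (3 / 10 : ℝ) ^ m * (17 / 10) ^ m := by rw [← mul_pow]; norm_num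
      rw [this]; ring
    have hq : (51 / 100 : ℝ) ^ 3 + (51 / 100) ^ 2 * ((m : ℝ) + 4) + (51 / 100) * (((m : ℝ) + 4) * ((m : ℝ) + 3) / 2) +
        ((m : ℝ) + 4) * ((m : ℝ) + 3) * ((m : ℝ) + 2) / 6 ≤ ((m : ℝ) + 4) ^ 3 / 4 := by
      have hu : (15 : ℝ) ≤ (m : ℝ) + 4 := by linarith
      have hu0 : (0 : ℝ) ≤ (m : ℝ) + 4 := by linarith
      nlinarith [mul_nonneg (mul_nonneg (sub_nonneg.2 hu) hu0) hu0, mul_nonneg (sub_nonneg.2 hu) hu0, sub_nonneg.2 hu]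
    have hp0 : 0 ≤ (3 / 10 : ℝ) ^ (m + 3) := by positivity
    have hp1 : 0 ≤ ((m : ℝ) + 4) * (3 / 10 : ℝ) ^ (m + 2) := by positivity
    have hp2 : 0 ≤ ((m : ℝ) + 4) * ((m : ℝ) + 3) / 2 * (3 / 10 : ℝ) ^ (m + 1) := by positivity
    have hp3 : 0 ≤ ((m : ℝ) + 4) * ((m : ℝ) + 3) * ((m : ℝ) + 2) / 6 * (3 / 10 : ℝ) ^ m := by positivity
    calc _ ≤ (3 / 10 : ℝ) ^ (m + 3) * (17 / 10 : ℝ) ^ (m + 4) + ((m : ℝ) + 4) * (3 / 10 : ℝ) ^ (m + 2) * (17 / 10 : ℝ) ^ (m + 3) +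
          ((m : ℝ) + 4) * ((m : ℝ) + 3) / 2 * (3 / 10 : ℝ) ^ (m + 1) * (17 / 10 : ℝ) ^ (m + 2) +
          ((m : ℝ) + 4) * ((m : ℝ) + 3) * ((m : ℝ) + 2) / 6 * (3 / 10 : ℝ) ^ m * (17 / 10 : ℝ) ^ (m + 1) := by
          nlinarith [mul_le_mul_of_nonneg_left h1 hp0, mul_le_mul_of_nonneg_left h2 hp1, mul_le_mul_of_nonneg_left h3 hp2,
            mul_le_mul_of_nonneg_left h4 hp3]
      _ = _ := e
      _ ≤ (17 / 10 : ℝ) * (51 / 100) ^ m * (((m : ℝ) + 4) ^ 3 / 4) := mul_le_mul_of_nonneg_left hq (by positivity)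
      _ = (17 / 40 : ℝ) * ((m : ℝ) + 4) ^ 3 * (51 / 100) ^ m := by ring
      _ ≤ 1 := hc
  · interval_cases m <;> norm_num

/-- `P₂(n) ≤ 1` for `n = m + 4 ≥ 8`: the four terms frozen at `y = 1/2` with `(1 − y/2)^i ≤ (17/20)^i`. [this work] -/
theorem pThreeTwo_le_one (m : ℕ) (hm : 4 ≤ m) :
    (1 / 2 : ℝ) ^ (m + 3) * (3 / 2 - 6 / ((m : ℝ) + 4)) ^ (m + 4) +
      ((m : ℝ) + 4) * (1 / 2 : ℝ) ^ (m + 2) * (17 / 20) * (3 / 2 - 6 / ((m : ℝ) + 4)) ^ (m + 3) +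
      ((m : ℝ) + 4) * ((m : ℝ) + 3) / 2 * (1 / 2 : ℝ) ^ (m + 1) * (17 / 20) ^ 2 * (3 / 2 - 6 / ((m : ℝ) + 4)) ^ (m + 2) +
      ((m : ℝ) + 4) * ((m : ℝ) + 3) * ((m : ℝ) + 2) / 6 * (1 / 2 : ℝ) ^ m * (17 / 20) ^ 3 * (3 / 2 - 6 / ((m : ℝ) + 4)) ^ (m + 1) ≤ 1 := by
  by_cases h33 : 33 ≤ m
  · have hm0 : (33 : ℝ) ≤ m := by exact_mod_cast h33
    have hB : (3 / 2 - 6 / ((m : ℝ) + 4)) ≤ 3 / 2 := by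
      have : 0 ≤ 6 / ((m : ℝ) + 4) := by positivity
      linarith
    have hB0 : 0 ≤ 3 / 2 - 6 / ((m : ℝ) + 4) := by
      rw [sub_nonneg, div_le_iff₀ (by positivity)]; nlinarith
    have h1 := pow_le_pow_left₀ hB0 hB (m + 4)
    have h2 := pow_le_pow_left₀ hB0 hB (m + 3)
    have h3 := pow_le_pow_left₀ hB0 hB (m + 2)
    have h4 := pow_le_pow_left₀ hB0 hB (m + 1)
    have hc := crudeThreeTwo_le_one m h33
    have e : (1 / 2 : ℝ) ^ (m + 3) * (3 / 2 : ℝ) ^ (m + 4) + ((m : ℝ) + 4) * (1 / 2 : ℝ) ^ (m + 2) * (17 / 20) * (3 / 2 : ℝ) ^ (m + 3) +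
        ((m : ℝ) + 4) * ((m : ℝ) + 3) / 2 * (1 / 2 : ℝ) ^ (m + 1) * (17 / 20) ^ 2 * (3 / 2 : ℝ) ^ (m + 2) +
        ((m : ℝ) + 4) * ((m : ℝ) + 3) * ((m : ℝ) + 2) / 6 * (1 / 2 : ℝ) ^ m * (17 / 20) ^ 3 * (3 / 2 : ℝ) ^ (m + 1) =
        (3 / 4 : ℝ) ^ m * ((1 / 2) ^ 3 * (3 / 2) ^ 4 + (1 / 2) ^ 2 * (17 / 20) * (3 / 2) ^ 3 * ((m : ℝ) + 4) +
          (1 / 2) * (17 / 20) ^ 2 * (3 / 2) ^ 2 * (((m : ℝ) + 4) * ((m : ℝ) + 3) / 2) +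
          (17 / 20) ^ 3 * (3 / 2) * (((m : ℝ) + 4) * ((m : ℝ) + 3) * ((m : ℝ) + 2) / 6)) := by
      have : (3 / 4 : ℝ) ^ m = (1 / 2 : ℝ) ^ m * (3 / 2) ^ m := by rw [← mul_pow]; norm_num
      rw [this]; ring
    have hq : (1 / 2 : ℝ) ^ 3 * (3 / 2) ^ 4 + (1 / 2) ^ 2 * (17 / 20) * (3 / 2) ^ 3 * ((m : ℝ) + 4) +
        (1 / 2) * (17 / 20) ^ 2 * (3 / 2) ^ 2 * (((m : ℝ) + 4) * ((m : ℝ) + 3) / 2) +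
        (17 / 20) ^ 3 * (3 / 2) * (((m : ℝ) + 4) * ((m : ℝ) + 3) * ((m : ℝ) + 2) / 6) ≤ (11 / 50) * ((m : ℝ) + 4) ^ 3 := by
      have hu : (37 : ℝ) ≤ (m : ℝ) + 4 := by linarith
      have hu0 : (0 : ℝ) ≤ (m : ℝ) + 4 := by linarith
      nlinarith [mul_nonneg (mul_nonneg (sub_nonneg.2 hu) hu0) hu0, mul_nonneg (sub_nonneg.2 hu) hu0, sub_nonneg.2 hu]
    have hp0 : 0 ≤ (1 / 2 : ℝ) ^ (m + 3) := by positivity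
    have hp1 : 0 ≤ ((m : ℝ) + 4) * (1 / 2 : ℝ) ^ (m + 2) * (17 / 20) := by positivity
    have hp2 : 0 ≤ ((m : ℝ) + 4) * ((m : ℝ) + 3) / 2 * (1 / 2 : ℝ) ^ (m + 1) * (17 / 20) ^ 2 := by positivity
    have hp3 : 0 ≤ ((m : ℝ) + 4) * ((m : ℝ) + 3) * ((m : ℝ) + 2) / 6 * (1 / 2 : ℝ) ^ m * (17 / 20) ^ 3 := by positivity
    calc _ ≤ (1 / 2 : ℝ) ^ (m + 3) * (3 / 2 : ℝ) ^ (m + 4) + ((m : ℝ) + 4) * (1 / 2 : ℝ) ^ (m + 2) * (17 / 20) * (3 / 2 : ℝ) ^ (m + 3) +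
          ((m : ℝ) + 4) * ((m : ℝ) + 3) / 2 * (1 / 2 : ℝ) ^ (m + 1) * (17 / 20) ^ 2 * (3 / 2 : ℝ) ^ (m + 2) +
          ((m : ℝ) + 4) * ((m : ℝ) + 3) * ((m : ℝ) + 2) / 6 * (1 / 2 : ℝ) ^ m * (17 / 20) ^ 3 * (3 / 2 : ℝ) ^ (m + 1) := by
          nlinarith [mul_le_mul_of_nonneg_left h1 hp0, mul_le_mul_of_nonneg_left h2 hp1, mul_le_mul_of_nonneg_left h3 hp2,
            mul_le_mul_of_nonneg_left h4 hp3]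
      _ = _ := e
      _ ≤ (3 / 4 : ℝ) ^ m * ((11 / 50) * ((m : ℝ) + 4) ^ 3) := mul_le_mul_of_nonneg_left hq (by positivity)
      _ = (11 / 50 : ℝ) * ((m : ℝ) + 4) ^ 3 * (3 / 4) ^ m := by ring
      _ ≤ 1 := hc
  · interval_cases m <;> norm_num

/-! ### 3. The envelope inequality for `r = 3` -/

/-- `n = 7`: `1 − E(7, y) ≥ 0` on `[0, 1/2]` (degree 13, positive Bernstein coefficients). [this work] -/
theorem envelopeThree_seven (y : ℝ) (hy0 : 0 ≤ y) (hy : y ≤ 1 / 2) :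
    y ^ 6 * (8 / 7 - y) ^ 7 + 7 * y ^ 5 * (1 - y / 2) * (8 / 7 - y) ^ 6 + 21 * y ^ 4 * (1 - y / 2) ^ 2 * (8 / 7 - y) ^ 5 +
      35 * y ^ 3 * (1 - y / 2) ^ 3 * (8 / 7 - y) ^ 4 ≤ 1 := by
  have h : 0 ≤ 1 / 2 - y := by linarith
  nlinarith [mul_nonneg (pow_nonneg hy0 13) (pow_nonneg h 0), mul_nonneg (pow_nonneg hy0 12) (pow_nonneg h 1),
    mul_nonneg (pow_nonneg hy0 11) (pow_nonneg h 2), mul_nonneg (pow_nonneg hy0 10) (pow_nonneg h 3),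
    mul_nonneg (pow_nonneg hy0 9) (pow_nonneg h 4), mul_nonneg (pow_nonneg hy0 8) (pow_nonneg h 5),
    mul_nonneg (pow_nonneg hy0 7) (pow_nonneg h 6), mul_nonneg (pow_nonneg hy0 6) (pow_nonneg h 7),
    mul_nonneg (pow_nonneg hy0 5) (pow_nonneg h 8), mul_nonneg (pow_nonneg hy0 4) (pow_nonneg h 9),
    mul_nonneg (pow_nonneg hy0 3) (pow_nonneg h 10), mul_nonneg (pow_nonneg hy0 2) (pow_nonneg h 11),
    mul_nonneg (pow_nonneg hy0 1) (pow_nonneg h 12), mul_nonneg (pow_nonneg hy0 0) (pow_nonneg h 13)]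

set_option maxHeartbeats 400000 in
/-- `n = m + 4 ≥ 8`: the two-interval argument. [this work] -/
theorem envelopeThree_ge_eight (m : ℕ) (hge : 4 ≤ m) (y : ℝ) (hy0 : 0 ≤ y) (hy : y ≤ 1 / 2) :
    y ^ (m + 3) * ((2 - 6 / ((m : ℝ) + 4)) - y) ^ (m + 4) + ((m : ℝ) + 4) * y ^ (m + 2) * (1 - y / 2) * ((2 - 6 / ((m : ℝ) + 4)) - y) ^ (m + 3) +
      ((m : ℝ) + 4) * ((m : ℝ) + 3) / 2 * y ^ (m + 1) * (1 - y / 2) ^ 2 * ((2 - 6 / ((m : ℝ) + 4)) - y) ^ (m + 2) +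
      ((m : ℝ) + 4) * ((m : ℝ) + 3) * ((m : ℝ) + 2) / 6 * y ^ m * (1 - y / 2) ^ 3 * ((2 - 6 / ((m : ℝ) + 4)) - y) ^ (m + 1) ≤ 1 := by
  set A : ℝ := 2 - 6 / ((m : ℝ) + 4) with hAval
  have hm0 : (0 : ℝ) ≤ m := Nat.cast_nonneg m
  have hm4 : (0 : ℝ) < (m : ℝ) + 4 := by positivity
  have hm4' : (4 : ℝ) ≤ m := by exact_mod_cast hge
  have h6 : 6 / ((m : ℝ) + 4) ≤ 3 / 4 := by rw [div_le_iff₀ hm4]; linarith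
  have h6' : 0 ≤ 6 / ((m : ℝ) + 4) := by positivity
  have hA_lo : 5 / 4 ≤ A := by rw [hAval]; linarith
  have hA_hi : A ≤ 2 := by rw [hAval]; linarith
  have hv0 : 0 ≤ 1 - y / 2 := by linarith
  have hAy : 0 ≤ A - y := by linarith
  have hyA1 : 0 ≤ y ^ (m + 2) * (A - y) ^ (m + 3) := by positivity
  have hyA2 : 0 ≤ y ^ (m + 1) * (A - y) ^ (m + 2) := by positivity
  have hyA3 : 0 ≤ y ^ m * (A - y) ^ (m + 1) := by positivity
  have hmA : (m : ℝ) * (5 / 4) ≤ (m : ℝ) * A := mul_le_mul_of_nonneg_left hA_lo hm0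
  have c2 : (0 : ℝ) ≤ ((m : ℝ) + 4) * ((m : ℝ) + 3) / 2 := by positivity
  have c3 : (0 : ℝ) ≤ ((m : ℝ) + 4) * ((m : ℝ) + 3) * ((m : ℝ) + 2) / 6 := by positivity
  by_cases hy1 : y ≤ 3 / 10
  · have hv1 : 1 - y / 2 ≤ 1 := by linarith
    have hlt : (3 / 10 : ℝ) < A := by linarith
    have hE0 := pow_mul_pow_le_endpoint (m + 3) (m + 4) A y (3 / 10) hy0 hy1 (by norm_num) hlt (by push_cast; linarith [hmA, hA_lo, hm4'])
    have hE1 := pow_mul_pow_le_endpoint (m + 2) (m + 3) A y (3 / 10) hy0 hy1 (by norm_num) hlt (by push_cast; linarith [hmA, hA_lo, hm4'])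
    have hE2 := pow_mul_pow_le_endpoint (m + 1) (m + 2) A y (3 / 10) hy0 hy1 (by norm_num) hlt (by push_cast; linarith [hmA, hA_lo, hm4'])
    have hE3 := pow_mul_pow_le_endpoint m (m + 1) A y (3 / 10) hy0 hy1 (by norm_num) hlt (by push_cast; linarith [hmA, hA_lo, hm4'])
    have hP := pThreeOne_le_one m hge
    have eA : A - 3 / 10 = 17 / 10 - 6 / ((m : ℝ) + 4) := by rw [hAval]; ring
    rw [eA] at hE0 hE1 hE2 hE3
    have hv2 : (1 - y / 2) ^ 2 ≤ 1 := by nlinarith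
    have hv3 : (1 - y / 2) ^ 3 ≤ 1 := by nlinarith
    have t1a : y ^ (m + 2) * (A - y) ^ (m + 3) * (1 - y / 2) ≤ (3 / 10 : ℝ) ^ (m + 2) * (17 / 10 - 6 / ((m : ℝ) + 4)) ^ (m + 3) := by
      have h := mul_le_mul_of_nonneg_left hv1 hyA1
      linarith
    have t2a : y ^ (m + 1) * (A - y) ^ (m + 2) * (1 - y / 2) ^ 2 ≤ (3 / 10 : ℝ) ^ (m + 1) * (17 / 10 - 6 / ((m : ℝ) + 4)) ^ (m + 2) := by
      have h := mul_le_mul_of_nonneg_left hv2 hyA2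
      linarith
    have t3a : y ^ m * (A - y) ^ (m + 1) * (1 - y / 2) ^ 3 ≤ (3 / 10 : ℝ) ^ m * (17 / 10 - 6 / ((m : ℝ) + 4)) ^ (m + 1) := by
      have h := mul_le_mul_of_nonneg_left hv3 hyA3
      linarith
    have t1 := mul_le_mul_of_nonneg_left t1a hm4.le
    have t2 := mul_le_mul_of_nonneg_left t2a c2
    have t3 := mul_le_mul_of_nonneg_left t3a c3
    have e1 : ((m : ℝ) + 4) * y ^ (m + 2) * (1 - y / 2) * (A - y) ^ (m + 3) = ((m : ℝ) + 4) * (y ^ (m + 2) * (A - y) ^ (m + 3) * (1 - y / 2)) := by ring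
    have e2 : ((m : ℝ) + 4) * ((m : ℝ) + 3) / 2 * y ^ (m + 1) * (1 - y / 2) ^ 2 * (A - y) ^ (m + 2) =
        ((m : ℝ) + 4) * ((m : ℝ) + 3) / 2 * (y ^ (m + 1) * (A - y) ^ (m + 2) * (1 - y / 2) ^ 2) := by ring
    have e3 : ((m : ℝ) + 4) * ((m : ℝ) + 3) * ((m : ℝ) + 2) / 6 * y ^ m * (1 - y / 2) ^ 3 * (A - y) ^ (m + 1) =
        ((m : ℝ) + 4) * ((m : ℝ) + 3) * ((m : ℝ) + 2) / 6 * (y ^ m * (A - y) ^ (m + 1) * (1 - y / 2) ^ 3) := by ring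
    rw [e1, e2, e3]
    linarith [hE0, t1, t2, t3, hP]
  · push Not at hy1
    have hv1 : 1 - y / 2 ≤ 17 / 20 := by linarith
    have hlt : (1 / 2 : ℝ) < A := by linarith
    have hE0 := pow_mul_pow_le_endpoint (m + 3) (m + 4) A y (1 / 2) hy0 hy (by norm_num) hlt (by push_cast; linarith [hmA, hA_lo, hm4'])
    have hE1 := pow_mul_pow_le_endpoint (m + 2) (m + 3) A y (1 / 2) hy0 hy (by norm_num) hlt (by push_cast; linarith [hmA, hA_lo, hm4'])
    have hE2 := pow_mul_pow_le_endpoint (m + 1) (m + 2) A y (1 / 2) hy0 hy (by norm_num) hlt (by push_cast; linarith [hmA, hA_lo, hm4'])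
    have hE3 := pow_mul_pow_le_endpoint m (m + 1) A y (1 / 2) hy0 hy (by norm_num) hlt (by push_cast; linarith [hmA, hA_lo, hm4'])
    have hP := pThreeTwo_le_one m hge
    have eA : A - 1 / 2 = 3 / 2 - 6 / ((m : ℝ) + 4) := by rw [hAval]; ring
    rw [eA] at hE0 hE1 hE2 hE3
    have hB0 : 0 ≤ 3 / 2 - 6 / ((m : ℝ) + 4) := by linarith
    have h12 : (0 : ℝ) ≤ 1 / 2 := by norm_num
    have hF1 := mul_nonneg (pow_nonneg h12 (m + 2)) (pow_nonneg hB0 (m + 3))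
    have hF2 := mul_nonneg (pow_nonneg h12 (m + 1)) (pow_nonneg hB0 (m + 2))
    have hF3 := mul_nonneg (pow_nonneg h12 m) (pow_nonneg hB0 (m + 1))
    have hv2 : (1 - y / 2) ^ 2 ≤ (17 / 20 : ℝ) ^ 2 := pow_le_pow_left₀ hv0 hv1 2
    have hv3 : (1 - y / 2) ^ 3 ≤ (17 / 20 : ℝ) ^ 3 := pow_le_pow_left₀ hv0 hv1 3
    have t1a : y ^ (m + 2) * (A - y) ^ (m + 3) * (1 - y / 2) ≤
        (1 / 2 : ℝ) ^ (m + 2) * (3 / 2 - 6 / ((m : ℝ) + 4)) ^ (m + 3) * (17 / 20) := mul_le_mul hE1 hv1 hv0 hF1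
    have t2a : y ^ (m + 1) * (A - y) ^ (m + 2) * (1 - y / 2) ^ 2 ≤
        (1 / 2 : ℝ) ^ (m + 1) * (3 / 2 - 6 / ((m : ℝ) + 4)) ^ (m + 2) * (17 / 20 : ℝ) ^ 2 := mul_le_mul hE2 hv2 (pow_nonneg hv0 2) hF2
    have t3a : y ^ m * (A - y) ^ (m + 1) * (1 - y / 2) ^ 3 ≤
        (1 / 2 : ℝ) ^ m * (3 / 2 - 6 / ((m : ℝ) + 4)) ^ (m + 1) * (17 / 20 : ℝ) ^ 3 := mul_le_mul hE3 hv3 (pow_nonneg hv0 3) hF3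
    have t1 := mul_le_mul_of_nonneg_left t1a hm4.le
    have t2 := mul_le_mul_of_nonneg_left t2a c2
    have t3 := mul_le_mul_of_nonneg_left t3a c3
    have e1 : ((m : ℝ) + 4) * y ^ (m + 2) * (1 - y / 2) * (A - y) ^ (m + 3) = ((m : ℝ) + 4) * (y ^ (m + 2) * (A - y) ^ (m + 3) * (1 - y / 2)) := by ring
    have e2 : ((m : ℝ) + 4) * ((m : ℝ) + 3) / 2 * y ^ (m + 1) * (1 - y / 2) ^ 2 * (A - y) ^ (m + 2) =
        ((m : ℝ) + 4) * ((m : ℝ) + 3) / 2 * (y ^ (m + 1) * (A - y) ^ (m + 2) * (1 - y / 2) ^ 2) := by ring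
    have e3 : ((m : ℝ) + 4) * ((m : ℝ) + 3) * ((m : ℝ) + 2) / 6 * y ^ m * (1 - y / 2) ^ 3 * (A - y) ^ (m + 1) =
        ((m : ℝ) + 4) * ((m : ℝ) + 3) * ((m : ℝ) + 2) / 6 * (y ^ m * (A - y) ^ (m + 1) * (1 - y / 2) ^ 3) := by ring
    have f1 : ((m : ℝ) + 4) * (1 / 2 : ℝ) ^ (m + 2) * (17 / 20) * (3 / 2 - 6 / ((m : ℝ) + 4)) ^ (m + 3) =
        ((m : ℝ) + 4) * ((1 / 2 : ℝ) ^ (m + 2) * (3 / 2 - 6 / ((m : ℝ) + 4)) ^ (m + 3) * (17 / 20)) := by ring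
    have f2 : ((m : ℝ) + 4) * ((m : ℝ) + 3) / 2 * (1 / 2 : ℝ) ^ (m + 1) * (17 / 20) ^ 2 * (3 / 2 - 6 / ((m : ℝ) + 4)) ^ (m + 2) =
        ((m : ℝ) + 4) * ((m : ℝ) + 3) / 2 * ((1 / 2 : ℝ) ^ (m + 1) * (3 / 2 - 6 / ((m : ℝ) + 4)) ^ (m + 2) * (17 / 20 : ℝ) ^ 2) := by ring
    have f3 : ((m : ℝ) + 4) * ((m : ℝ) + 3) * ((m : ℝ) + 2) / 6 * (1 / 2 : ℝ) ^ m * (17 / 20) ^ 3 * (3 / 2 - 6 / ((m : ℝ) + 4)) ^ (m + 1) =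
        ((m : ℝ) + 4) * ((m : ℝ) + 3) * ((m : ℝ) + 2) / 6 * ((1 / 2 : ℝ) ^ m * (3 / 2 - 6 / ((m : ℝ) + 4)) ^ (m + 1) * (17 / 20 : ℝ) ^ 3) := by
      ring
    rw [e1, e2, e3]
    rw [f1, f2, f3] at hP
    linarith [hE0, t1, t2, t3, hP]

/-- **`E(n, 3, y) ≤ 1`** for `n ≥ 7`, `0 ≤ y ≤ 1/2`, in the syntactic form of `…QuantAtMostRBound`'s hypothesis at `r = 3`. [this work] -/
theorem envelopeThree_le_one (n : ℕ) (hn : 7 ≤ n) (y : ℝ) (hy0 : 0 ≤ y) (hy : y ≤ 1 / 2) :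
    ∑ i ∈ Finset.range (3 + 1), (n.choose i : ℝ) * y ^ (n - 1 - i) * (1 - y / 2) ^ i * (2 - y - 2 * (3 : ℝ) / n) ^ (n - i) ≤ 1 := by
  obtain ⟨m, rfl⟩ : ∃ m, n = m + 4 := ⟨n - 4, by omega⟩
  have hm3 : 3 ≤ m := by omega
  rw [Finset.sum_range_succ, Finset.sum_range_succ, Finset.sum_range_succ, Finset.sum_range_one]
  have hc0 : ((m + 4).choose 0 : ℝ) = 1 := by simp
  have hc1 : ((m + 4).choose 1 : ℝ) = (m : ℝ) + 4 := by rw [Nat.choose_one_right]; push_cast; ring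
  have k1 : (m + 3) * (m + 2).choose 1 = (m + 3).choose 2 * 2 := Nat.add_one_mul_choose_eq (m + 2) 1
  have k2 : (m + 4) * (m + 3).choose 2 = (m + 4).choose 3 * 3 := Nat.add_one_mul_choose_eq (m + 3) 2
  rw [Nat.choose_one_right] at k1
  have k1' : ((m : ℝ) + 3) * ((m : ℝ) + 2) = (((m + 3).choose 2 : ℕ) : ℝ) * 2 := by exact_mod_cast k1
  have k2' : ((m : ℝ) + 4) * (((m + 3).choose 2 : ℕ) : ℝ) = (((m + 4).choose 3 : ℕ) : ℝ) * 3 := by exact_mod_cast k2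
  have k3 : (m + 4) * (m + 3).choose 1 = (m + 4).choose 2 * 2 := Nat.add_one_mul_choose_eq (m + 3) 1
  rw [Nat.choose_one_right] at k3
  have k3' : ((m : ℝ) + 4) * ((m : ℝ) + 3) = (((m + 4).choose 2 : ℕ) : ℝ) * 2 := by exact_mod_cast k3
  have hc2 : ((m + 4).choose 2 : ℝ) = ((m : ℝ) + 4) * ((m : ℝ) + 3) / 2 := by linarith
  have hc3 : ((m + 4).choose 3 : ℝ) = ((m : ℝ) + 4) * ((m : ℝ) + 3) * ((m : ℝ) + 2) / 6 := by nlinarith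
  have e0 : m + 4 - 1 - 0 = m + 3 := by omega
  have e1 : m + 4 - 1 - 1 = m + 2 := by omega
  have e2 : m + 4 - 1 - 2 = m + 1 := by omega
  have e3 : m + 4 - 1 - 3 = m := by omega
  have e4 : m + 4 - 0 = m + 4 := by omega
  have e5 : m + 4 - 1 = m + 3 := by omega
  have e6 : m + 4 - 2 = m + 2 := by omega
  have e7 : m + 4 - 3 = m + 1 := by omega
  rw [hc0, hc1, hc2, hc3, e0, e1, e2, e3, e4, e5, e6, e7]
  have hmR : ((m + 4 : ℕ) : ℝ) = (m : ℝ) + 4 := by push_cast; ring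
  rw [hmR]
  have hA' : ∀ t : ℝ, 2 - t - 2 * (3 : ℝ) / ((m : ℝ) + 4) = (2 - 6 / ((m : ℝ) + 4)) - t := fun t => by ring
  simp only [hA', pow_zero, pow_one, mul_one, one_mul]
  rcases Nat.lt_or_ge m 4 with hlt | hge
  · have hm : m = 3 := by omega
    subst hm
    have h := envelopeThree_seven y hy0 hy
    norm_num at h ⊢
    linarith
  · exact envelopeThree_ge_eight m hge y hy0 hy

end IndepBlob

end Quant

end Summit.CriticalPhenomena.PercolationContinuityZ3.Theorems
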